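import Summits.CriticalPhenomena.PercolationContinuityZ3.Theorems.SoloBlindPeriodicFinAllRoots
import Literature.Probability.Percolation.NonBacktrackingPathCounting
import HarnessLib

/-!
# The fully attached fin under a QUANTITATIVE line rate

The open FIN RUNG (`SoloBlindOpenRungs.FinRung`: `θ(p_c(ℤ³)) = 0` on `ℤ³[{x₀ ≥ 0} ∪ {x₁ = 0}]`, the
half-space with a whole half-plane glued on along a line) is the case `M = 1` of the periodic fins, where
the qualitative hypothesis `LineRate` (`Σ_w τ_ℍ(w) < ∞`) no longer suffices for the chain argument of
`SoloBlindPeriodicFin*`: the fin-side kernel does not become small.  Keeping the two connector-edge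
factors `p_c` that the qualitative estimates discard, the contraction criterion of
`SoloBlindPeriodicFin.measure_percolatesVia_eq_zero` reads, for `M = 1`,

  `ρ₁ ≤ p_c² · T₀ · B₀`,   `T₀ = Σ_{w ≠ 0} τ_ℍ(w)`,   `B₀ = Σ_{w ≠ 0} β(w)`,

where `τ_ℍ(w) = P_{p_c}(0 ↔ (0,0,w) inside ℍ)` is the half-space boundary two-point function along the
attachment line and `β(w) = P_{p_c}((-1,0,0) ↔ (-1,0,w) inside the planar half-plane {x₁ = 0, x₀ ≤ -1})`
is the (subcritical, planar) fin-side one.  THEOREM (`finRung_of_quantitativeLineRate`):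

  `p_c(ℤ³)² · T₀ · B₀ < 1  ⟹  FinRung`  (indeed `finPeriods = ℕ`: no periodic fin percolates, at any root).

So the fin rung is `LineRate` WITH A CONSTANT.  Numerically (`p_c ≈ 0.2488`, `T₀ = 2 Σ_{z ≥ 1} τ_ℍ(z) ≈ 1.24`
from a boundary Monte Carlo, `B₀ ≈ 0.73` from a planar one: `β(1) ≈ 0.262, β(2) ≈ 0.073, β(3) ≈ 0.021, …`)
the left side is `≈ 0.056`, a margin of `≈ 18`; rigorously `B₀ < ∞` is known (planar sharpness below
`p_c(ℤ²) = 1/2 > p_c(ℤ³)`) but `T₀ < ∞` is exactly `LineRate`, and no numerical bound on either is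
available (an explicit bound on `B₀` would already need a quantitative upper bound on `p_c(ℤ³)`).
-/

noncomputable section

namespace Summit.CriticalPhenomena.PercolationContinuityZ3.Theorems

open MeasureTheory Filter Topology Literature.Probability.Percolation Literature.Probability.LatticeModels
open scoped ENNReal

/-- The planar half-plane carrying every fin: `P⁻ = {x₁ = 0, x₀ ≤ -1}`. -/
def finPlane : Set (Site 3) := {x : Site 3 | x 1 = 0 ∧ x 0 ≤ -1}

/-- The fin-side boundary two-point function `β(w) = P_{p_c}((-1,0,0) ↔ (-1,0,w) inside P⁻)`. -/
def betaF (w : ℤ) : ℝ≥0∞ :=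
  Pc (openConnVia (withinGraph (zdGraph 3) finPlane) (cpt false 0) (cpt false w))

/-- `p_c(ℤ³)` as an extended non-negative real. -/
def pcE : ℝ≥0∞ := ENNReal.ofReal (criticalProbI 3 : ℝ)

/-- `T₀ = Σ_{w ≠ 0} τ_ℍ(w)`, the off-diagonal half-space line sum. -/
def T0 : ℝ≥0∞ := ∑' w : ℤ, Set.indicator {w : ℤ | w ≠ 0} tauH w

/-- `B₀ = Σ_{w ≠ 0} β(w)`, the off-diagonal fin line sum. -/
def B0 : ℝ≥0∞ := ∑' w : ℤ, Set.indicator {w : ℤ | w ≠ 0} betaF w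

/-! ### Edge marginals and connector adjacency -/

/-- An edge of `ℤ³` is open with probability `p_c` under `P_{p_c}`. -/
theorem Pc_edge {a b : Site 3} (h : (zdGraph 3).Adj a b) : Pc {ω | s(a, b) ∈ ω} = pcE := by
  have hr := bondPercolation_cylinder (zdGraph 3) (criticalProbI 3)
    (e := s(a, b)) ((SimpleGraph.mem_edgeSet _).2 h)
  unfold pcE
  rw [← hr, measureReal_def, ENNReal.ofReal_toReal (measure_ne_top _ _)]
  rfl

/-- `0 < p_c(ℤ³)` (indeed `p_c ≥ 1/5`). -/
theorem pcE_pos : 0 < pcE := by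
  unfold pcE
  rw [ENNReal.ofReal_pos]
  have h := inv_le_criticalProbI (d := 3) (by norm_num)
  have h5 : (0 : ℝ) < 1 / (2 * (3 : ℕ) - 1 : ℝ) := by norm_num
  exact h5.trans_le h

/-- The connector `(0,0,z)` and its foot `(-1,0,z)` are adjacent in `ℤ³`. -/
theorem cpt_adj (z : ℤ) : (zdGraph 3).Adj (cpt true z) (cpt false z) :=
  (zdGraph_adj_iff _ _).2 ⟨0, Or.inr (by simp [cpt])⟩

/-- Consecutive feet `(-1,0,w)`, `(-1,0,w+1)` are adjacent in `ℤ³`. -/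
theorem cpt_false_adj_succ (w : ℤ) : (zdGraph 3).Adj (cpt false w) (cpt false (w + 1)) := by
  refine (zdGraph_adj_iff _ _).2 ⟨2, Or.inl ?_⟩
  ext i
  fin_cases i <;> simp [cpt]

/-- Feet lie in the fin plane. -/
theorem cpt_false_mem_finPlane (w : ℤ) : cpt false w ∈ finPlane := by
  refine ⟨by simp [cpt], by simp [cpt]⟩

/-! ### Translation invariance along the attachment line, fin side -/

/-- Translation invariance of `β` along the `x₂`-axis. -/
theorem measure_openConnVia_finPlane_shift (z w : ℤ) :
    Pc (openConnVia (withinGraph (zdGraph 3) finPlane) (cpt false z) (cpt false (w + z))) = betaF w := by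
  let v : Site 3 := Function.update (0 : Site 3) 2 z
  have hv0 : v 0 = 0 := by simp [v]
  have hv1 : v 1 = 0 := by simp [v]
  have hK : ∀ u u' : Site 3, (withinGraph (zdGraph 3) finPlane).Adj (Site.shift v u) (Site.shift v u') ↔
      (withinGraph (zdGraph 3) finPlane).Adj u u' := by
    intro u u'
    rw [withinGraph_adj, withinGraph_adj, zdGraph_adj_shift_iff]
    simp only [finPlane, Set.mem_setOf_eq, Site.shift_apply, Pi.add_apply, hv0, hv1, add_zero]
  have hpre := relabel_preimage_openConnVia (Site.shift v) hK (cpt false 0) (cpt false w)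
  have hreal := bondPercolation_real_preimage_shift v (criticalProbI 3)
    (openConnVia (withinGraph (zdGraph 3) finPlane) (Site.shift v (cpt false 0))
      (Site.shift v (cpt false w)))
  rw [hpre] at hreal
  rw [measureReal_def, measureReal_def,
    ENNReal.toReal_eq_toReal_iff' (measure_ne_top _ _) (measure_ne_top _ _)] at hreal
  have h0 : Site.shift v (cpt false 0) = cpt false z := by
    ext i
    fin_cases i <;> simp [v, cpt, Site.shift_apply]
  have hw : Site.shift v (cpt false w) = cpt false (w + z) := by
    ext i
    fin_cases i <;> simp [v, cpt, Site.shift_apply]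
  rw [h0, hw] at hreal
  exact hreal.symm

/-! ### The two kernels with their `p_c` factors -/

/-- Half-space kernel: `κ_ℍ(z,z') ≤ 1[z' ≠ z] τ_ℍ(z'-z) · p_c`. -/
theorem kerZ_true_le_pc (Z : Set ℤ) (z z' : ℤ) :
    kerZ Z true z z' ≤ Set.indicator {w : ℤ | w ≠ 0} tauH (z' - z) * pcE := by
  unfold kerZ
  by_cases h : z ∈ Z ∧ z' ∈ Z ∧ z' ≠ z
  · rw [Set.indicator_of_mem (show z' - z ∈ {w : ℤ | w ≠ 0} from sub_ne_zero.2 h.2.2)]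
    calc admInd Z z z' * (Pc (openConnVia (K0 Z) (cpt true z) (cpt true z')) *
          Pc {ω | s(cpt true z', cpt (!true) z') ∈ ω})
        ≤ 1 * (tauH (z' - z) * pcE) :=
          mul_le_mul' (admInd_le_one z z')
            (mul_le_mul' (measure_openConnVia_K0_hsp_le Z z z') (Pc_edge (cpt_adj z')).le)
      _ = tauH (z' - z) * pcE := one_mul _
  · rw [admInd_eq_zero h, zero_mul]
    exact bot_le

/-- Fin kernel: `κ_F(z,z') ≤ 1[z' ≠ z] β(z'-z) · p_c`. -/
theorem kerZ_false_le_pc (Z : Set ℤ) (z z' : ℤ) :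
    kerZ Z false z z' ≤ Set.indicator {w : ℤ | w ≠ 0} betaF (z' - z) * pcE := by
  unfold kerZ
  by_cases h : z ∈ Z ∧ z' ∈ Z ∧ z' ≠ z
  · obtain ⟨hz, -, hne⟩ := h
    rw [Set.indicator_of_mem (show z' - z ∈ {w : ℤ | w ≠ 0} from sub_ne_zero.2 hne)]
    have hsub : openConnVia (K0 Z) (cpt false z) (cpt false z') ⊆
        openConnVia (withinGraph (zdGraph 3) finPlane) (cpt false z) (cpt false z') :=
      fun ω hω => openClusterIn_mono_graph (withinGraph_mono _ (finZ_subset_plane Z)) ω _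
        (piece_subset_of_mem_finZ (cpt_mem_sideSet (Z := Z) false hz) hω)
    have hβ : Pc (openConnVia (K0 Z) (cpt false z) (cpt false z')) ≤ betaF (z' - z) := by
      refine (measure_mono hsub).trans_eq ?_
      have := measure_openConnVia_finPlane_shift z (z' - z)
      rwa [sub_add_cancel] at this
    have hedge : Pc {ω | s(cpt false z', cpt (!false) z') ∈ ω} = pcE := by
      have := Pc_edge (cpt_adj z')
      rwa [Sym2.eq_swap] at this
    calc admInd Z z z' * (Pc (openConnVia (K0 Z) (cpt false z) (cpt false z')) *
          Pc {ω | s(cpt false z', cpt (!false) z') ∈ ω})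
        ≤ 1 * (betaF (z' - z) * pcE) :=
          mul_le_mul' (admInd_le_one z z') (mul_le_mul' hβ hedge.le)
      _ = betaF (z' - z) * pcE := one_mul _
  · rw [admInd_eq_zero h, zero_mul]
    exact bot_le

/-- `κ̄_ℍ ≤ T₀ · p_c`. -/
theorem kerTot_true_le_pc (Z : Set ℤ) : kerTot (kerZ Z) true ≤ T0 * pcE := by
  refine iSup_le fun z => ?_
  calc ∑' z', kerZ Z true z z' ≤ ∑' z', Set.indicator {w : ℤ | w ≠ 0} tauH (z' - z) * pcE :=
        ENNReal.tsum_le_tsum (kerZ_true_le_pc Z z)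
    _ = (∑' z', Set.indicator {w : ℤ | w ≠ 0} tauH (z' - z)) * pcE := ENNReal.tsum_mul_right
    _ = T0 * pcE := by
        rw [T0, ← (Equiv.subRight z).tsum_eq (Set.indicator {w : ℤ | w ≠ 0} tauH)]
        rfl

/-- `κ̄_F ≤ B₀ · p_c`. -/
theorem kerTot_false_le_pc (Z : Set ℤ) : kerTot (kerZ Z) false ≤ B0 * pcE := by
  refine iSup_le fun z => ?_
  calc ∑' z', kerZ Z false z z' ≤ ∑' z', Set.indicator {w : ℤ | w ≠ 0} betaF (z' - z) * pcE :=
        ENNReal.tsum_le_tsum (kerZ_false_le_pc Z z)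
    _ = (∑' z', Set.indicator {w : ℤ | w ≠ 0} betaF (z' - z)) * pcE := ENNReal.tsum_mul_right
    _ = B0 * pcE := by
        rw [B0, ← (Equiv.subRight z).tsum_eq (Set.indicator {w : ℤ | w ≠ 0} betaF)]
        rfl

/-! ### Finiteness of `T₀` from the quantitative hypothesis -/

/-- `B₀ ≥ β(1) ≥ p_c > 0`: the single edge `(-1,0,0) ∼ (-1,0,1)` of the fin plane. -/
theorem B0_pos : 0 < B0 := by
  have h1 : pcE ≤ betaF 1 := by
    rw [← Pc_edge (cpt_false_adj_succ 0)]
    refine measure_mono fun ω hω => ?_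
    change cpt false 1 ∈ openClusterIn _ ω (cpt false 0)
    have h01 : (0 : ℤ) + 1 = 1 := zero_add 1
    refine mem_openClusterIn_of_adj (self_mem_openClusterIn _ ω _) ?_ (by simpa [h01] using hω)
    rw [withinGraph_adj]
    exact ⟨by simpa [h01] using cpt_false_adj_succ 0, cpt_false_mem_finPlane 0, cpt_false_mem_finPlane 1⟩
  have h2 : betaF 1 ≤ B0 := by
    calc betaF 1 = Set.indicator {w : ℤ | w ≠ 0} betaF 1 := (Set.indicator_of_mem (by simp) _).symm
      _ ≤ B0 := ENNReal.le_tsum (1 : ℤ)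
  exact pcE_pos.trans_le (h1.trans h2)

/-- Under `p_c² T₀ B₀ < 1` the line sum `T₀` is finite. -/
theorem T0_ne_top (h : pcE ^ 2 * (T0 * B0) < 1) : T0 ≠ ⊤ := by
  intro hT
  rw [hT, ENNReal.top_mul B0_pos.ne', ENNReal.mul_top (pow_ne_zero 2 pcE_pos.ne')] at h
  exact absurd h (by simp)

/-- `Σ_w τ_ℍ(w) = τ_ℍ(0) + T₀ ≤ 1 + T₀`. -/
theorem tsum_tauH_le : ∑' w, tauH w ≤ 1 + T0 := by
  have hsplit : ∀ w : ℤ, tauH w ≤ Set.indicator {w : ℤ | w = 0} (fun _ => (1 : ℝ≥0∞)) w +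
      Set.indicator {w : ℤ | w ≠ 0} tauH w := by
    intro w
    by_cases hw : w = 0
    · subst hw
      rw [Set.indicator_of_mem (by simp), Set.indicator_of_notMem (by simp), add_zero]
      exact prob_le_one
    · rw [Set.indicator_of_notMem (by simpa using hw), Set.indicator_of_mem (by simpa using hw),
        zero_add]
  calc ∑' w, tauH w ≤ ∑' w : ℤ, (Set.indicator {w : ℤ | w = 0} (fun _ => (1 : ℝ≥0∞)) w +
        Set.indicator {w : ℤ | w ≠ 0} tauH w) := ENNReal.tsum_le_tsum hsplit
    _ = (∑' w : ℤ, Set.indicator {w : ℤ | w = 0} (fun _ => (1 : ℝ≥0∞)) w) + T0 := ENNReal.tsum_add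
    _ = 1 + T0 := by
        congr 1
        rw [show {w : ℤ | w = 0} = ({0} : Set ℤ) from by ext; simp]
        rw [← Finset.coe_singleton, tsum_eq_sum (s := {0})
          (fun w hw => Set.indicator_of_notMem (by simpa using hw) _)]
        simp

/-! ### The theorem -/

/-- **The fully attached fin under a quantitative line rate.** If
`p_c(ℤ³)² · Σ_{w≠0} τ_ℍ(w) · Σ_{w≠0} β(w) < 1` then `1 ∈ finPeriods`, i.e. the FIN RUNG holds:
`θ(p_c(ℤ³)) = 0` on `ℤ³[{x₀ ≥ 0} ∪ {x₁ = 0}]`. -/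
theorem one_mem_finPeriods_of_quantitativeLineRate (h : pcE ^ 2 * (T0 * B0) < 1) :
    1 ∈ finPeriods := by
  intro h0
  have hT := T0_ne_top h
  have hΓ : ∑' z, startZ (ZM 1) (0 : Site 3) true z ≠ ⊤ :=
    ne_top_of_le_ne_top (by simpa using hT) ((tsum_startZ_le (ZM 1)).trans tsum_tauH_le)
  have hρ : kerTot (kerZ (ZM 1)) true * kerTot (kerZ (ZM 1)) false < 1 := by
    calc kerTot (kerZ (ZM 1)) true * kerTot (kerZ (ZM 1)) false
        ≤ T0 * pcE * (B0 * pcE) := mul_le_mul' (kerTot_true_le_pc _) (kerTot_false_le_pc _)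
      _ = pcE ^ 2 * (T0 * B0) := by ring
      _ < 1 := h
  have hzero := measure_percolatesVia_eq_zero (Z := ZM 1) (0 : Site 3) true zero_mem_hsp hΓ hρ
  rw [theta_induce_eq_real_percolatesVia, measureReal_def]
  change (Pc (percolatesVia (KS (ZM 1)) 0)).toReal = 0
  rw [hzero, ENNReal.toReal_zero]

/-- **FinRung from a quantitative line rate.** -/
theorem finRung_of_quantitativeLineRate (h : pcE ^ 2 * (T0 * B0) < 1) :
    SoloBlindOpenRungs.FinRung :=
  one_mem_finPeriods_iff.1 (one_mem_finPeriods_of_quantitativeLineRate h)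

/-- Hence, under the quantitative line rate, EVERY period is good (`finPeriods = ℕ`): no periodic
fin percolates at `p_c(ℤ³)`, at any root. -/
theorem finPeriods_eq_univ_of_quantitativeLineRate (h : pcE ^ 2 * (T0 * B0) < 1) :
    finPeriods = Set.univ :=
  finPeriods_eq_univ_iff.2 (finRung_of_quantitativeLineRate h)

/-- … and in particular `θ_{ℤ³[{x₀ ≥ 0} ∪ {x₁ = 0}]}(x, p_c(ℤ³)) = 0` at every root `x` (through
`periodicFinRegion 1 = {x₀ ≥ 0 ∨ x₁ = 0}` and `theta_eq_zero_of_mem_finPeriods`). -/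
theorem theta_fin_eq_zero_of_quantitativeLineRate (h : pcE ^ 2 * (T0 * B0) < 1) (x : Site 3)
    (hx : x ∈ periodicFinRegion 1) :
    theta ((zdGraph 3).induce (periodicFinRegion 1)) ⟨x, hx⟩ (criticalProbI 3) = 0 :=
  theta_eq_zero_of_mem_finPeriods (one_mem_finPeriods_of_quantitativeLineRate h) x hx

end Summit.CriticalPhenomena.PercolationContinuityZ3.Theorems

end
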